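import Literature.Geometry.Lorentzian.SpacetimeLocalConvergence
import Literature.Geometry.Lorentzian.KerrSchildCoord
import Summits.FinalStateConjecture.FinalStateConjecture.Theorems.BartnikGapSettlingGapExhaustionCylindersBendInwardOf
import HarnessLib

/-!
# `InjectiveMfderivOfClose`: immersion from closeness of the pulled-back form to a coercive form
(crux `GapExhaustion`, stmt-FinalStateConjecture-10808, line photon-shell-pseudoconvexity;
stub (W2-C) `stub_injective_mfderiv_of_close`, node glue)

The line's rigidity node hypothesis `FarSilentNearKerr` gives a smooth open embedding whose
pulled-back metric components are `δ`-close to the Kerr–Schild form, but no immersion clause,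
while the landed chart-level theorems need `Function.Injective (mfderiv … Φ z)`. This file
supplies the two bricks closing that gap:

1. **generic**: if the pulled-back form `𝓢.metricInCoords Φ z = (v, w) ↦ g(dΦ_z v, dΦ_z w)` is
   within `β` (operator norm) of a form `B` that is coercive in the sense `β‖v‖ ≤ ‖B v‖`
   (operator norm of the covector `B v : E4 →L[ℝ] ℝ`), then `dΦ_z` is injective — for
   `dΦ_z v = 0` forces `metricInCoords Φ z v = 0`, whence
   `β‖v‖ ≤ ‖B v‖ = ‖(metricInCoords Φ z − B) v‖ ≤ ‖metricInCoords Φ z − B‖ ‖v‖ < β‖v‖`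
   unless `v = 0`;
2. **Kerr**: the Kerr–Schild forms `Kerr.bilin M a z` are uniformly coercive on every radial band
   `0 < r_lo ≤ r ≤ r_hi` (all times): nondegenerate at each point with `r > 0`
   (`Kerr.bilin_nondegenerate`), continuous (`Kerr.contDiffAt_bilin`), so `‖g_{M,a}(z) v‖` has a
   positive minimum on the compact set `{x⁰ = 0, r_lo ≤ r ≤ r_hi} × {‖v‖ = 1}`
   (`kerrCylindersBendInward_isCompact_slice`, `isCompact_sphere`), which is transported to all
   times by stationarity (`Kerr.bilin_add_smul_basisVector_zero`,
   `Kerr.radius_add_time_smul_basisVector`) and to all `v` by homogeneity.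
-/

noncomputable section

-- instance search through the nested operator types `E4 →L[ℝ] E4 →L[ℝ] ℝ`
set_option maxSynthPendingDepth 3

-- D-0017: single-problem summit, `Summit.<S>.<S>.…` by design (cf. lakefile `weak.linter.dupNamespace`).
set_option linter.dupNamespace false

namespace Summit.FinalStateConjecture.FinalStateConjecture.Theorems

open Set Literature.Geometry.Lorentzian
open scoped Manifold ContDiff Topology

/-- **Coercivity from a bound on unit vectors** (homogeneity of the operator norm): if
`β ≤ ‖B u‖` for every unit vector `u`, then `β‖v‖ ≤ ‖B v‖` for every `v`. [folklore] -/
theorem injClose_coercive_of_sphere (B : E4 →L[ℝ] E4 →L[ℝ] ℝ) {β : ℝ}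
    (h : ∀ u ∈ Metric.sphere (0 : E4) 1, β ≤ ‖B u‖) (v : E4) : β * ‖v‖ ≤ ‖B v‖ := by
  rcases eq_or_ne v 0 with rfl | hv
  · simp
  · have hvn : 0 < ‖v‖ := norm_pos_iff.mpr hv
    have hu : ‖v‖⁻¹ • v ∈ Metric.sphere (0 : E4) 1 := by
      rw [mem_sphere_zero_iff_norm, norm_smul, norm_inv, norm_norm, inv_mul_cancel₀ hvn.ne']
    have h1 := h _ hu
    rw [map_smul, norm_smul, norm_inv, norm_norm, le_inv_mul_iff₀ hvn, mul_comm] at h1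
    exact h1

/-- **Uniform coercivity of the Kerr–Schild forms on the compact time slice
`{x⁰ = 0, r_lo ≤ r ≤ r_hi}`, `r_lo > 0`**: the continuous function `(z, u) ↦ ‖g_{M,a}(z) u‖` is
positive on the compact set `slice × unit sphere` (nondegeneracy of `g_{M,a}` wherever `r > 0`,
Kerr–Schild 1965, §2), hence bounded below by a positive constant. [folklore] -/
theorem injClose_kerr_coercive_slice (M a r_lo r_hi : ℝ) (hlo : 0 < r_lo) :
    ∃ β : ℝ, 0 < β ∧
      ∀ z ∈ {z : E4 | z 0 = 0 ∧ r_lo ≤ Kerr.radius a z ∧ Kerr.radius a z ≤ r_hi},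
        ∀ v : E4, β * ‖v‖ ≤ ‖Kerr.bilin M a z v‖ := by
  set S : Set E4 := {z | z 0 = 0 ∧ r_lo ≤ Kerr.radius a z ∧ Kerr.radius a z ≤ r_hi} with hSdef
  have hS : IsCompact S := kerrCylindersBendInward_isCompact_slice a r_hi hlo
  have hSpos : ∀ z ∈ S, 0 < Kerr.radius a z := fun z hz ↦ hlo.trans_le hz.2.1
  have hK : IsCompact (S ×ˢ Metric.sphere (0 : E4) 1) := hS.prod (isCompact_sphere 0 1)
  have hcont : ContinuousOn (fun p : E4 × E4 ↦ ‖Kerr.bilin M a p.1 p.2‖)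
      (S ×ˢ Metric.sphere (0 : E4) 1) := by
    refine ContinuousOn.norm (ContinuousOn.clm_apply ?_ continuous_snd.continuousOn)
    intro p hp
    exact ((Kerr.contDiffAt_bilin M a (hSpos p.1 hp.1) (n := 0)).continuousAt.comp
      continuousAt_fst).continuousWithinAt
  have hpos : ∀ p ∈ S ×ˢ Metric.sphere (0 : E4) 1, (0 : ℝ) < ‖Kerr.bilin M a p.1 p.2‖ := by
    intro p hp
    rw [norm_pos_iff]
    intro h0
    have hv : p.2 = 0 :=
      Kerr.bilin_nondegenerate M a (hSpos p.1 hp.1) p.2 fun w ↦ by rw [h0]; rfl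
    have h1 : ‖p.2‖ = 1 := mem_sphere_zero_iff_norm.mp hp.2
    rw [hv, norm_zero] at h1
    exact zero_ne_one h1
  obtain ⟨β, hβ, hle⟩ := hK.exists_forall_le' hcont hpos
  refine ⟨β, hβ, fun z hz ↦ injClose_coercive_of_sphere (Kerr.bilin M a z) fun u hu ↦ ?_⟩
  exact hle (z, u) ⟨hz, hu⟩

/-- **Nondegeneracy from closeness to a coercive form**: if `β‖v‖ ≤ ‖B v‖` for all `v` and
`‖G − B‖ < β` (operator norms), then `G(v, ·) = 0` forces `v = 0` — otherwise
`β‖v‖ ≤ ‖B v‖ = ‖(G − B) v‖ ≤ ‖G − B‖ ‖v‖ < β‖v‖`. (Openness of the invertible forms, quantified;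
Rudin, *Functional Analysis*, Thm. 10.11 ff.) [folklore] -/
theorem injClose_nondegenerate_of_norm_sub_lt {G B : E4 →L[ℝ] E4 →L[ℝ] ℝ} {β : ℝ}
    (hcoer : ∀ v : E4, β * ‖v‖ ≤ ‖B v‖) (hclose : ‖G - B‖ < β) (v : E4)
    (hv : ∀ w : E4, G v w = 0) : v = 0 := by
  by_contra hne
  have hvn : 0 < ‖v‖ := norm_pos_iff.mpr hne
  have hG : G v = 0 := ContinuousLinearMap.ext hv
  have h1 : ‖B v‖ ≤ ‖G - B‖ * ‖v‖ := by
    have h : B v = -((G - B) v) := by rw [sub_apply, hG, zero_sub, neg_neg]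
    rw [h, norm_neg]
    exact ContinuousLinearMap.le_opNorm _ _
  have h2 : ‖G - B‖ * ‖v‖ < β * ‖v‖ := mul_lt_mul_of_pos_right hclose hvn
  exact absurd (hcoer v) (not_le.mpr (h1.trans_lt h2))

/-- **Injectivity of the differential from closeness of the pulled-back form to a coercive
form**: if `‖Φ^* g (z) − B‖ < β` and `β‖v‖ ≤ ‖B v‖` for all `v`, then `dΦ_z` is injective —
`dΦ_z v = 0` forces `(Φ^* g)(z)(v, ·) = g(dΦ_z v, dΦ_z ·) = 0`, and `Φ^* g (z)` is nondegenerate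
by `injClose_nondegenerate_of_norm_sub_lt` (the kernel step is that of
`Spacetime.injective_mfderiv_of_metricInCoords_nondegenerate` of `BackgroundChartCalculus.lean`,
inlined to keep the import closure of this glue file small; O'Neill 1983, Ch. 3, p. 90).
[folklore] -/
theorem injClose_injective_mfderiv (𝓢 : Spacetime.{0} 4) (Φ : E4 → 𝓢.carrier) (z : E4)
    (B : E4 →L[ℝ] E4 →L[ℝ] ℝ) {β : ℝ} (hcoer : ∀ v : E4, β * ‖v‖ ≤ ‖B v‖)
    (hclose : ‖𝓢.metricInCoords Φ z - B‖ < β) :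
    Function.Injective (mfderiv 𝓘(ℝ, E4) (𝓡 4) Φ z) := by
  refine (injective_iff_map_eq_zero (mfderiv 𝓘(ℝ, E4) (𝓡 4) Φ z)).2 fun v hv ↦
    injClose_nondegenerate_of_norm_sub_lt hcoer hclose v fun w ↦ ?_
  rw [Spacetime.metricInCoords_apply, hv, map_zero, zero_apply]

/-- (W2-C) immersion from closeness: a chart whose pulled-back form at `z` is closer to an
invertible form `B` than `‖B⁻¹‖⁻¹` has injective differential at `z`; and the Kerr–Schild forms
have uniformly bounded inverses on every band `0 < r_lo ≤ r ≤ r_hi` (all times) — the band point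
`z` at time `t = z⁰` is translated to the compact slice `{x⁰ = 0}` (`z = z' + t ∂₀`) and Kerr is
stationary. [folklore; Kerr–Schild 1965, §2 (nondegeneracy and stationarity of `g_{M,a}`)] -/
theorem stub_injective_mfderiv_of_close :
    (∀ (𝓢 : Spacetime.{0} 4) (Φ : E4 → 𝓢.carrier) (z : E4) (B : E4 →L[ℝ] E4 →L[ℝ] ℝ) (β : ℝ),
      0 < β → (∀ v : E4, β * ‖v‖ ≤ ‖B v‖) → ‖𝓢.metricInCoords Φ z - B‖ < β →
      Function.Injective (mfderiv 𝓘(ℝ, E4) (𝓡 4) Φ z)) ∧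
    (∀ (M a r_lo r_hi : ℝ), 0 < r_lo → r_lo ≤ r_hi →
      ∃ β : ℝ, 0 < β ∧ ∀ z : E4, r_lo ≤ Kerr.radius a z → Kerr.radius a z ≤ r_hi →
        ∀ v : E4, β * ‖v‖ ≤ ‖Kerr.bilin M a z v‖) := by
  refine ⟨fun 𝓢 Φ z B β _ hcoer hclose ↦ injClose_injective_mfderiv 𝓢 Φ z B hcoer hclose, ?_⟩
  intro M a r_lo r_hi hlo _
  obtain ⟨β, hβ, hS⟩ := injClose_kerr_coercive_slice M a r_lo r_hi hlo
  refine ⟨β, hβ, fun z hzlo hzhi v ↦ ?_⟩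
  -- translate `z` to the time slice: `z = z' + t ∂₀`, `t = z⁰`
  obtain ⟨t, ht⟩ : ∃ t : ℝ, z 0 = t := ⟨_, rfl⟩
  obtain ⟨z', hz'z⟩ : ∃ z' : E4, z' + t • E4.basisVector 0 = z :=
    ⟨z - t • E4.basisVector 0, sub_add_cancel z _⟩
  have hz'0 : z' 0 = 0 := by
    have h : (z' + t • E4.basisVector 0) 0 = z 0 := by rw [hz'z]
    rw [ht] at h
    simpa [E4.basisVector] using h
  -- stationarity of Kerr: the radius and the components agree
  have hrad' : Kerr.radius a z' = Kerr.radius a z := by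
    rw [← hz'z, Kerr.radius_add_time_smul_basisVector]
  have hbil' : Kerr.bilin M a z' = Kerr.bilin M a z := by
    rw [← hz'z, Kerr.bilin_add_smul_basisVector_zero]
  have hz'S : z' ∈ {z : E4 | z 0 = 0 ∧ r_lo ≤ Kerr.radius a z ∧ Kerr.radius a z ≤ r_hi} :=
    ⟨hz'0, hzlo.trans_eq hrad'.symm, hrad'.trans_le hzhi⟩
  have h := hS z' hz'S v
  rwa [hbil'] at h

end Summit.FinalStateConjecture.FinalStateConjecture.Theorems

end
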